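import Summits.ValiantsHypothesis.ValiantsHypothesis.Theses.PolyaContinued
import Literature.Computability.AlgebraicComplexity.QPBoundedClosure

/-!
# ValiantsHypothesis / PolyaContinued — item `PfaffianCoverHardSplitGlue` (stmt-ValiantsHypothesis-18009), closed

Split glue of the deciding crux: `MonotoneCoverHard ∧ CoverDecancellation ⟹ PfaffianCoverHard`.
Were there Pfaffian covers of `per_n` of size `m ≤ 2^((log₂ n + c₀)^c₀)` for all `n`, decancellation
(exponent `c₁`) would turn each into a MONOTONE cover of size `m' ≤ 2^((log₂ m + c₁)^c₁)`, and
`qp ∘ qp = qp` (`qexp_comp_le`: `(log₂ m + c₁)^c₁ ≤ (log₂ n + c)^c` for an explicit `c = c(c₀, c₁)`)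
makes this a monotone cover family of quasi-polynomial size, contradicting `MonotoneCoverHard`.
HONEST FRAMING: bookkeeping; both hypotheses are OPEN; nothing here is progress on `VP ≠ VNP`.
-/

-- layout Summits/ValiantsHypothesis/ValiantsHypothesis forces the duplicated namespace component
set_option linter.dupNamespace false

namespace Summit.ValiantsHypothesis.ValiantsHypothesis.Theorems.PolyaContinued

open Literature.Computability.AlgebraicComplexity

/-- **`qp ∘ qp = qp`, exponent form**: if `m ≤ 2^((log₂ n + c₀)^c₀)` then
`(log₂ m + c₁)^c₁ ≤ (log₂ n + c)^c` with `c = (max c₀ c₁ + 2) * c₁ + (max c₀ c₁ + 2)` (as in the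
tree's `IsQPBounded.two_pow_qexp_log`). [folklore] -/
theorem qexp_comp_le (c₀ c₁ : ℕ) {n m : ℕ} (hm : m ≤ 2 ^ ((Nat.log 2 n + c₀) ^ c₀)) :
    (Nat.log 2 m + c₁) ^ c₁ ≤
      (Nat.log 2 n + ((max c₀ c₁ + 2) * c₁ + (max c₀ c₁ + 2))) ^ ((max c₀ c₁ + 2) * c₁ + (max c₀ c₁ + 2)) := by
  have h1 : Nat.log 2 m ≤ (Nat.log 2 n + c₀) ^ c₀ :=
    calc Nat.log 2 m ≤ Nat.log 2 (2 ^ ((Nat.log 2 n + c₀) ^ c₀)) := Nat.log_mono_right hm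
      _ = (Nat.log 2 n + c₀) ^ c₀ := Nat.log_pow Nat.one_lt_two _
  have h2 : Nat.log 2 m + c₁ ≤ (Nat.log 2 n + (max c₀ c₁ + 2)) ^ (max c₀ c₁ + 2) := by
    have ha := IsQPBounded.qexp_mono (Nat.log 2 n) (le_max_left c₀ c₁)
    have hb := (IsQPBounded.le_qexp (Nat.log 2 n) c₁).trans
      (IsQPBounded.qexp_mono (Nat.log 2 n) (le_max_right c₀ c₁))
    have h3 := IsQPBounded.three_mul_qexp_le (Nat.log 2 n) (max c₀ c₁)
    omega
  calc (Nat.log 2 m + c₁) ^ c₁ ≤ ((Nat.log 2 n + (max c₀ c₁ + 2)) ^ (max c₀ c₁ + 2)) ^ c₁ :=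
        Nat.pow_le_pow_left h2 c₁
    _ = (Nat.log 2 n + (max c₀ c₁ + 2)) ^ ((max c₀ c₁ + 2) * c₁) := by rw [← pow_mul]
    _ ≤ (Nat.log 2 n + ((max c₀ c₁ + 2) * c₁ + (max c₀ c₁ + 2))) ^ ((max c₀ c₁ + 2) * c₁) :=
        Nat.pow_le_pow_left (by omega) _
    _ ≤ (Nat.log 2 n + ((max c₀ c₁ + 2) * c₁ + (max c₀ c₁ + 2))) ^
          ((max c₀ c₁ + 2) * c₁ + (max c₀ c₁ + 2)) :=
        Nat.pow_le_pow_right (by omega) (by omega)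

/-- **Item `PfaffianCoverHardSplitGlue` (stmt-ValiantsHypothesis-18009):**
`MonotoneCoverHard → CoverDecancellation → PfaffianCoverHard`. [folklore] -/
theorem pfaffianCoverHardSplitGlue_proof : Theses.PolyaContinued.PfaffianCoverHardSplitGlue := by
  unfold Theses.PolyaContinued.PfaffianCoverHardSplitGlue Theses.PolyaContinued.MonotoneCoverHard
    Theses.PolyaContinued.CoverDecancellation Theses.PolyaContinued.PfaffianCoverHard
  rintro hMono ⟨c₁, hDec⟩ ⟨c₀, hPf⟩
  apply hMono
  refine ⟨(max c₀ c₁ + 2) * c₁ + (max c₀ c₁ + 2), fun n => ?_⟩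
  obtain ⟨m, hm, E, P, hP, hs, hproj⟩ := hPf n
  obtain ⟨m', hm', E', P', hP', hs', a, ha, hper⟩ := hDec n m ⟨E, P, hP, hs, hproj⟩
  refine ⟨m', hm'.trans (Nat.pow_le_pow_right Nat.two_pos (qexp_comp_le c₀ c₁ hm)), E', P', hP', hs',
    a, ha, hper⟩

end Summit.ValiantsHypothesis.ValiantsHypothesis.Theorems.PolyaContinued
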